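/-
Copyright (c) 2026 the pub-hodgecm-mathlib formalisation cell (harness21).  Prover seat hodgecm-mathlib-K2E1-p08 (g5), Track B ∕ K2-LIT, h413 =
`stmt-HodgeConjecture-24833`, campaign «EIS-RANK-ONE» (q5) [D5]₃ SPHERICAL, Fréchet road, file (a3)₃: the CENTRE-LAYER archimedean smoothness binder of ★ p857895
DISCHARGED for the spherical flat section of `U(2,1)` over a CM field (dealer K2E1-plan (g4) 2026-09-04T06:47:48Z).
-/
import Summits.HodgeConjecture.HodgeConjecture.Theorems.K2E1HeightBigCellLineFormulaU3      -- ★ (a2)₃ p858090: `H(ι(w₀)·u(X, θ(ι⁻¹ s, b))·k) = ((∏_w (A_w + c_w s_w²))·h_f)⁻¹`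
import Summits.HodgeConjecture.HodgeConjecture.Theorems.K2E1OnePlusSqPowerSymbolUniform   -- ★ (a1ᵘ): `(A + c s²)^{−z}` is a symbol, ONE constant for all `A ≥ 1`
import Summits.HodgeConjecture.HodgeConjecture.Theorems.K2E1HeightLineArchSmoothU2         -- ★ (a3)₂ p858035: `ofReal_inv_prod_mul_cpow`, `norm_ofReal_inv_cpow_mul_prod_rpow_neg` (cpow bookkeeping)
import Summits.HodgeConjecture.HodgeConjecture.Theorems.K2E1TensorSymbolProduct             -- ★ (a3 core) p857958: `norm_iteratedFDeriv_mul_le_of_envelopes`, `norm_iteratedFDeriv_comp_form_le`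
import Summits.HodgeConjecture.HodgeConjecture.Theorems.K2E1FlatSectionLineRestrictionArchU3  -- ★ p857895 ∕ p857905 (K2E4-p11 (g3)): the consumer, centre layer (F)
import HarnessLib

/-!
# K2·E1 — `K2E1HeightLineArchSmoothU3` ((q5) [D5]₃ file (a3)₃): THE CENTRE-LAYER BINDER `hφarch` OF ★ p857895 HOLDS FOR THE SPHERICAL FLAT SECTION OF `U(2,1)` —
# `s ↦ f_z(ι(w₀)·u(X, θ(ι⁻¹ s, b))·k)` is `C^m` on `L⁺ ⊗ ℝ` with `‖Dʲ‖ ≤ C_φ·H^{Re z}` (`j ≤ m`), ONE `C_φ` for all `k ∈ K_U`, `X ∈ 𝔸_L`, `b ∈ 𝔸_{L⁺}^∞`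

Track B ∕ K2-LIT, crux h413 = `stmt-HodgeConjecture-24833`, route of record `HCCMUnconditional`; cell `hodgecm-mathlib`, squad K2, ENGINE E1, campaign EIS-RANK-ONE, queue item (q5)
[D5]₃ SPHERICAL.  Prover seat `hodgecm-mathlib-K2E1-p08` (g5).  THEOREMS ONLY (no `def`, no `instance`, no notation, no named-fact hypothesis, no `sorry`); lane `--kind proof
--supports stmt-HodgeConjecture-24833 --as helper` (count-neutral, closes no socket).

WHAT.  ★ p857895 `K2E1FlatSectionLineRestrictionArchU3.exists_fibre_majorant_centre_of_archSmooth_three` ((F), the centre layer of the Poisson summation on the Heisenberg group of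
`U(J₃)`) takes ONE archimedean input, the binder
`hφarch : ∀ k ∈ K, ∀ X b, ContDiff ℝ m ((a ↦ f(ι(w₀)·u(X, θ(a, b))·k)) ∘ ι⁻¹) ∧ ∀ j ≤ m, ∀ s, ‖Dʲ((a ↦ f(ι(w₀)·u(X, θ(a, b))·k)) ∘ ι⁻¹)(s)‖ ≤ 𝓔(ι(w₀)·u(X, θ(ι⁻¹ s, b))·k)`
(`u = heisChart hc`, `θ = traceZeroLine`, `ι = ringEquiv_mixedSpace L⁺`).  THIS FILE PROVES IT over a CM field `L` for the spherical flat section `f = flatSectionU (fun _ => φ₀) z = φ₀·H^z`,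
`K = K_U`, and the envelope `𝓔 = C_φ·H^{Re z}`: **`exists_archSmooth_flatSectionU_const_cm_three`** — `∀ z φ₀ m, ∃ C_φ ≥ 0, hφarch` VERBATIM, the constant uniform in `k`, `X`, `b`.
HOW.  §1 the tensor Leibniz rule with an EXPLICIT constant `(2ᵐC)^{#s}` (★ (a3 core) two-factor step, induction) — needed because the per-`X` functions change while the constant may
not.  §2 by ★ (a2)₃ the section along the line is `φ₀·(h_f⁻¹)^z·∏_w (A_w(X) + c_w s_{w|L⁺}²)^{−z}` with `A_w = (1 + ½‖X_w‖²)² ≥ 1`, `c_w = (wδ)²` (`flatSectionU_const_heisChart_line_apply_cm_three`).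
§3 ★ (a1ᵘ) `exists_norm_iteratedFDeriv_affine_le_uniform` bounds every factor's derivatives by `C·(A_w + c_w s²)^{−Re z}` with `C` independent of `A_w ≥ 1`, i.e. of `X`; §1 multiplies;
★ (a3)₂'s cpow bookkeeping turns `‖φ₀‖·h_f^{−Re z}·∏_w (A_w + c_w s_w²)^{−Re z}` into `‖φ₀‖·H^{Re z}`.
§4 PLUGS IT IN: **`exists_fibre_majorant_centre_const_cm_three`** = ★ p857895 `exists_fibre_majorant_centre_of_archSmooth_three` for the spherical flat section on `K = K_U` with the
envelope `C_φ·H^{Re z}`, `hφarch` supplied by §3 and `h𝓔U` by the level letter `U₀ ≤ GL₃(𝒪̂_L)`; what remains as input is the integrability of `t ↦ H(ι(w₀)·u(X, θ t)·k)^{Re z}` along the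
centre lines with a bound `N(X)` (Godement-range data, (D2-d)).
[MoeglinWaldspurger1995, I.2.10–I.2.12, II.1.5; Hörmander ALPDO I §7.1; Garrett2018, §2.2, §12.2; Rogawski1990, §1.10.]

HONEST LABEL: HC_CM is proved only modulo the 7 printed citations (2 remaining named inputs: hLiu418 = `stmt-HodgeConjecture-24832`, h413 = `stmt-HodgeConjecture-24833`) until
rung 0 closes; count-neutral helper, closes no socket.  The `E`-LAYER binder `hφarchZ` (derivatives in `X_∞` of the centre-averaged section) is NOT in this file.

## References
* [MoeglinWaldspurger1995] C. Mœglin, J.-L. Waldspurger, *Spectral Decomposition and Eisenstein Series* (1995), I.2.10–I.2.12, II.1.5.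
* [HormanderALPDO1] L. Hörmander, *The Analysis of Linear Partial Differential Operators I* (1983), §7.1.
* [Garrett2018] P. Garrett, *Modern Analysis of Automorphic Forms by Example* (2018), §2.2, §12.2.
* [Rogawski1990] J. D. Rogawski, *Automorphic Representations of Unitary Groups in Three Variables* (1990), §1.10.
-/

set_option autoImplicit false
-- the mandated namespace repeats the single-problem summit's segment (`HodgeConjecture.HodgeConjecture`)
set_option linter.dupNamespace false

noncomputable section

open NumberField NumberField.InfinitePlace NumberField.mixedEmbedding IsDedekindDomain
open Literature.NumberTheory.Automorphic Literature.NumberTheory.Automorphic.UnitaryGroup AdelicGroupData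
open Summit.HodgeConjecture.HodgeConjecture.Cruxes.H413.K2E1BorelEisensteinU
open Summit.HodgeConjecture.HodgeConjecture.Cruxes.H413.K2E1HeightBigCellLineFormulaU3
open Summit.HodgeConjecture.HodgeConjecture.Cruxes.H413.K2E1OnePlusSqPowerSymbol (onePlusSq_pos)
open Summit.HodgeConjecture.HodgeConjecture.Cruxes.H413.K2E1OnePlusSqPowerSymbolUniform
open Summit.HodgeConjecture.HodgeConjecture.Cruxes.H413.K2E1HeightLineArchSmoothU2 (ofReal_inv_prod_mul_cpow norm_ofReal_inv_cpow_mul_prod_rpow_neg norm_proj_comp_fst_le_one)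
open Summit.HodgeConjecture.HodgeConjecture.Cruxes.H413.K2E1TensorSymbolProduct
-- `Classical` is needed to see the Mathlib normed-space instances on `mixedSpace` (note H5 of `AdelicGLnGlue`)
open scoped NNReal ContDiff Classical

namespace Summit.HodgeConjecture.HodgeConjecture.Cruxes.H413.K2E1HeightLineArchSmoothU3

/-! ## §1 The tensor Leibniz rule with an explicit constant -/

section Tensor

variable {X : Type*} [NormedAddCommGroup X] [NormedSpace ℝ X] {𝔸 : Type*} [NormedCommRing 𝔸] [NormOneClass 𝔸] [NormedAlgebra ℝ 𝔸]

/-- **FINITE PRODUCTS OF SYMBOLS, EXPLICIT CONSTANT**: under the hypotheses of ★ (a3 core) `exists_norm_iteratedFDeriv_finset_prod_le` (`‖Dʲgᵢ‖ ≤ C·eᵢ`, `j ≤ m`, `eᵢ ≥ 0`, `C ≥ 0`)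
the product satisfies `‖Dʲ(∏_{i∈s} gᵢ)(x)‖ ≤ (2ᵐ·C)^{#s} · ∏_{i∈s} eᵢ(x)` for all `j ≤ m` — the constant depends on `(m, C, #s)` only, not on the `gᵢ`. [cite: HormanderALPDO1, §7.1] -/
theorem norm_iteratedFDeriv_finset_prod_le_explicit {ι : Type*} (s : Finset ι) {g : ι → X → 𝔸} {N : WithTop ℕ∞} (hg : ∀ i ∈ s, ContDiff ℝ N (g i))
    {m : ℕ} (hm : (m : WithTop ℕ∞) ≤ N) {C : ℝ} (hC : 0 ≤ C) {e : ι → X → ℝ} (he : ∀ i ∈ s, ∀ x, 0 ≤ e i x)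
    (hb : ∀ i ∈ s, ∀ j ≤ m, ∀ x, ‖iteratedFDeriv ℝ j (g i) x‖ ≤ C * e i x) :
    ContDiff ℝ N (fun x => ∏ i ∈ s, g i x) ∧
      ∀ j ≤ m, ∀ x, ‖iteratedFDeriv ℝ j (fun x => ∏ i ∈ s, g i x) x‖ ≤ (2 ^ m * C) ^ s.card * ∏ i ∈ s, e i x := by
  classical
  induction s using Finset.induction_on with
  | empty =>
    refine ⟨by simpa using contDiff_const, fun j _ x => ?_⟩
    simp only [Finset.prod_empty, Finset.card_empty, pow_zero, mul_one]
    rcases Nat.eq_zero_or_pos j with rfl | hjpos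
    · rw [norm_iteratedFDeriv_zero, norm_one]
    · rw [iteratedFDeriv_const_of_ne (𝕜 := ℝ) hjpos.ne' (1 : 𝔸)]
      simp
  | insert a s ha ih =>
    have hga : ContDiff ℝ N (g a) := hg a (Finset.mem_insert_self a s)
    obtain ⟨hprod, hbound⟩ := ih (fun i hi => hg i (Finset.mem_insert_of_mem hi)) (fun i hi => he i (Finset.mem_insert_of_mem hi))
      (fun i hi => hb i (Finset.mem_insert_of_mem hi))
    have hfun : (fun x => ∏ i ∈ insert a s, g i x) = fun x => g a x * ∏ i ∈ s, g i x := by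
      funext x; rw [Finset.prod_insert ha]
    refine ⟨by rw [hfun]; exact hga.mul hprod, fun j hj x => ?_⟩
    rw [hfun, Finset.prod_insert ha, Finset.card_insert_of_notMem ha, pow_succ]
    have h := norm_iteratedFDeriv_mul_le_of_envelopes (e₁ := e a) (e₂ := fun x => ∏ i ∈ s, e i x) hga hprod hm hC (pow_nonneg (by positivity) _)
      (he a (Finset.mem_insert_self a s)) (fun x => Finset.prod_nonneg fun i hi => he i (Finset.mem_insert_of_mem hi) x)
      (hb a (Finset.mem_insert_self a s)) hbound hj x
    calc ‖iteratedFDeriv ℝ j (fun y => g a y * ∏ i ∈ s, g i y) x‖ ≤ 2 ^ m * C * (2 ^ m * C) ^ s.card * (e a x * ∏ i ∈ s, e i x) := h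
      _ = (2 ^ m * C) ^ s.card * (2 ^ m * C) * (e a x * ∏ i ∈ s, e i x) := by ring

end Tensor

/-! ## §2 The spherical flat section along the big-cell Heisenberg line, in closed form -/

section Line

variable (L : Type) [Field L] [NumberField L] [IsCMField L]

/-- **THE SPHERICAL FLAT SECTION ALONG THE HEISENBERG LINE IS A TENSOR PRODUCT OF AFFINE SYMBOLS**: for `k ∈ K_U`, `X ∈ 𝔸_L`, `b ∈ 𝔸_{L⁺}^∞`, `s ∈ L⁺ ⊗ ℝ`,
`f_z(ι(w₀)·u(X, θ(ι⁻¹ s, b))·k) = φ₀ · (h_f(X,b)⁻¹)^z · ∏_{w∣∞} ((1 + ½‖X_w‖²)² + (wδ)²·s_{w|L⁺}²)^{−z}` (★ (a2)₃ `coe_borelHeight_weylLongU_heisChart_line_mul_eq_cm_three`, ★ (a3)₂ §1).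
[cite: MoeglinWaldspurger1995, II.1.5, I.2.2] [cite: Rogawski1990, §1.10] -/
theorem flatSectionU_const_heisChart_line_apply_cm_three (hc : IsCMField.complexConj L * IsCMField.complexConj L = 1) {δ : L} (hcδ : IsCMField.complexConj L δ = -δ) (hδ : δ ≠ 0)
    (z φ₀ : ℂ) {k : (quasiSplit (↥(maximalRealSubfield L)) L (IsCMField.complexConj L) 3).Adelic}
    (hk : k ∈ ((standardMaximalCompactGL 3 L).comap (adelicVal ↥(maximalRealSubfield L) L (IsCMField.complexConj L) 3 ((StdForm.antidiagonal 3).over L)) : Subgroup (quasiSplit (↥(maximalRealSubfield L)) L (IsCMField.complexConj L) 3).Adelic))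
    (X : AdeleRing (𝓞 L) L) (b : FiniteAdeleRing (𝓞 ↥(maximalRealSubfield L)) ↥(maximalRealSubfield L)) (s : mixedSpace ↥(maximalRealSubfield L)) :
    ((fun a : InfiniteAdeleRing ↥(maximalRealSubfield L) => flatSectionU (fun _ : (quasiSplit (↥(maximalRealSubfield L)) L (IsCMField.complexConj L) 3).Adelic => φ₀) z
        (((quasiSplit (↥(maximalRealSubfield L)) L (IsCMField.complexConj L) 3).toAdelic (weylLongU ((IsCMField.complexConj L : L ≃ₐ[↥(maximalRealSubfield L)] L) : L →+* L) (rfl : ((StdForm.antidiagonal 3).over L) = ((StdForm.antidiagonal 3).over L)))) *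
          ((heisChart hc (X, traceZeroLine ↥(maximalRealSubfield L) L (IsCMField.complexConj L) hcδ hδ ((a, b) : AdeleRing (𝓞 ↥(maximalRealSubfield L)) ↥(maximalRealSubfield L))) : ↥(adelicUnipotent ↥(maximalRealSubfield L) L (IsCMField.complexConj L) 3)) : (quasiSplit (↥(maximalRealSubfield L)) L (IsCMField.complexConj L) 3).Adelic) * k)) ∘
      (InfiniteAdeleRing.ringEquiv_mixedSpace ↥(maximalRealSubfield L)).symm) s =
      φ₀ * ((((((∏ᶠ v : HeightOneSpectrum (𝓞 L), max 1 (max ‖X.2 v‖₊ ‖(heisZ (c := IsCMField.complexConj L) X ((traceZeroLine ↥(maximalRealSubfield L) L (IsCMField.complexConj L) hcδ hδ ((0, b) : AdeleRing (𝓞 ↥(maximalRealSubfield L)) ↥(maximalRealSubfield L)) : traceZeroAdele ↥(maximalRealSubfield L) L (IsCMField.complexConj L)) : AdeleRing (𝓞 L) L)).2 v‖₊) : ℝ≥0) : ℝ))⁻¹ : ℝ) : ℂ) ^ z *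
        ∏ w : InfinitePlace L, (((((1 + ‖X.1 w‖ ^ 2 / 2) ^ 2 + (w δ) ^ 2 * (s.1 ⟨w.comap (algebraMap ↥(maximalRealSubfield L) L), K2E1HeightBigCellLineFormulaU2.isReal_comap_maximalRealSubfield L w⟩) ^ 2 : ℝ)) : ℂ) ^ (-z))) := by
  rw [Function.comp_apply, flatSectionU_apply, coe_borelHeight_weylLongU_heisChart_line_mul_eq_cm_three L hc hcδ hδ hk X b s,
    ofReal_inv_prod_mul_cpow Finset.univ (fun w _ => (affine_pos (zero_lt_one.trans_le (one_le_sq_one_add_half_norm_sq L X w)) (sq_nonneg (w δ)) _).le)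
      (zero_le_one.trans (one_le_coe_finprod_heisZ_line_cm_three L hcδ hδ X b)) z]

end Line

/-! ## §3 The centre-layer binder `hφarch` for the spherical flat section, uniformly in the shift `X` -/

section ArchSmooth

variable (L : Type) [Field L] [NumberField L] [IsCMField L]

/-- **(q5) [D5]₃ SPHERICAL, CENTRE LAYER — THE ARCHIMEDEAN SMOOTHNESS BINDER `hφarch` OF ★ p857895 HOLDS FOR `φ ≡ φ₀`.**  For a CM field `L`, `δ ∈ L⁻ ∖ 0`, ANY `z ∈ ℂ`, `φ₀ ∈ ℂ`,
`m ∈ ℕ` there is `C_φ ≥ 0` such that for every `k ∈ K_U`, EVERY shift `X ∈ 𝔸_L` and every `b ∈ 𝔸_{L⁺}^∞` the function `(a ↦ f_z(ι(w₀)·u(X, θ(a, b))·k)) ∘ ι⁻¹` on `mixedSpace L⁺`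
is `C^m` with `‖Dʲ(…)(s)‖ ≤ C_φ·H(ι(w₀)·u(X, θ(ι⁻¹ s, b))·k)^{Re z}` (`j ≤ m`) — LITERALLY the hypothesis `hφarch` of ★ `exists_fibre_majorant_centre_of_archSmooth_three` at
`f := flatSectionU (fun _ => φ₀) z`, `K := K_U`, `𝓔 := fun y => C_φ·H(y)^{Re z}`.  Proof: §2 closed form; per place ★ (a1ᵘ) (ONE constant for all `A_w(X) ≥ 1`) pulled back
along `ℓ_w` (★ (a3 core)); §1 with the explicit constant `(2ᵐ·C_max)^{#places}`; ★ (a3)₂ cpow bookkeeping; `C_φ = ‖φ₀‖·(2ᵐ·C_max)^{#places}`.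
[cite: MoeglinWaldspurger1995, I.2.10–I.2.12, II.1.5] [cite: HormanderALPDO1, §7.1] [cite: Garrett2018, §2.2, §12.2] -/
theorem exists_archSmooth_flatSectionU_const_cm_three (hc : IsCMField.complexConj L * IsCMField.complexConj L = 1) {δ : L} (hcδ : IsCMField.complexConj L δ = -δ) (hδ : δ ≠ 0)
    (z φ₀ : ℂ) (m : ℕ) :
    ∃ Cφ : ℝ, 0 ≤ Cφ ∧
    ∀ k ∈ (((standardMaximalCompactGL 3 L).comap (adelicVal ↥(maximalRealSubfield L) L (IsCMField.complexConj L) 3 ((StdForm.antidiagonal 3).over L)) : Subgroup (quasiSplit (↥(maximalRealSubfield L)) L (IsCMField.complexConj L) 3).Adelic) : Set (quasiSplit (↥(maximalRealSubfield L)) L (IsCMField.complexConj L) 3).Adelic), ∀ (X : AdeleRing (𝓞 L) L) (b : FiniteAdeleRing (𝓞 ↥(maximalRealSubfield L)) ↥(maximalRealSubfield L)),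
      ContDiff ℝ m ((fun a : InfiniteAdeleRing ↥(maximalRealSubfield L) => flatSectionU (fun _ : (quasiSplit (↥(maximalRealSubfield L)) L (IsCMField.complexConj L) 3).Adelic => φ₀) z (((quasiSplit (↥(maximalRealSubfield L)) L (IsCMField.complexConj L) 3).toAdelic (weylLongU ((IsCMField.complexConj L : L ≃ₐ[↥(maximalRealSubfield L)] L) : L →+* L) (rfl : ((StdForm.antidiagonal 3).over L) = ((StdForm.antidiagonal 3).over L)))) * ((heisChart hc (X, traceZeroLine ↥(maximalRealSubfield L) L (IsCMField.complexConj L) hcδ hδ ((a, b) : AdeleRing (𝓞 ↥(maximalRealSubfield L)) ↥(maximalRealSubfield L))) : ↥(adelicUnipotent ↥(maximalRealSubfield L) L (IsCMField.complexConj L) 3)) : (quasiSplit (↥(maximalRealSubfield L)) L (IsCMField.complexConj L) 3).Adelic) * k)) ∘ (InfiniteAdeleRing.ringEquiv_mixedSpace ↥(maximalRealSubfield L)).symm) ∧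
      ∀ j : ℕ, j ≤ m → ∀ s : mixedSpace ↥(maximalRealSubfield L),
        ‖iteratedFDeriv ℝ j ((fun a : InfiniteAdeleRing ↥(maximalRealSubfield L) => flatSectionU (fun _ : (quasiSplit (↥(maximalRealSubfield L)) L (IsCMField.complexConj L) 3).Adelic => φ₀) z (((quasiSplit (↥(maximalRealSubfield L)) L (IsCMField.complexConj L) 3).toAdelic (weylLongU ((IsCMField.complexConj L : L ≃ₐ[↥(maximalRealSubfield L)] L) : L →+* L) (rfl : ((StdForm.antidiagonal 3).over L) = ((StdForm.antidiagonal 3).over L)))) * ((heisChart hc (X, traceZeroLine ↥(maximalRealSubfield L) L (IsCMField.complexConj L) hcδ hδ ((a, b) : AdeleRing (𝓞 ↥(maximalRealSubfield L)) ↥(maximalRealSubfield L))) : ↥(adelicUnipotent ↥(maximalRealSubfield L) L (IsCMField.complexConj L) 3)) : (quasiSplit (↥(maximalRealSubfield L)) L (IsCMField.complexConj L) 3).Adelic) * k)) ∘ (InfiniteAdeleRing.ringEquiv_mixedSpace ↥(maximalRealSubfield L)).symm) s‖ ≤ Cφ * (borelHeight (((quasiSplit (↥(maximalRealSubfield L))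 L (IsCMField.complexConj L) 3).toAdelic (weylLongU ((IsCMField.complexConj L : L ≃ₐ[↥(maximalRealSubfield L)] L) : L →+* L) (rfl : ((StdForm.antidiagonal 3).over L) = ((StdForm.antidiagonal 3).over L)))) * ((heisChart hc (X, traceZeroLine ↥(maximalRealSubfield L) L (IsCMField.complexConj L) hcδ hδ ((((InfiniteAdeleRing.ringEquiv_mixedSpace ↥(maximalRealSubfield L)).symm s), b) : AdeleRing (𝓞 ↥(maximalRealSubfield L)) ↥(maximalRealSubfield L))) : ↥(adelicUnipotent ↥(maximalRealSubfield L) L (IsCMField.complexConj L) 3)) : (quasiSplit (↥(maximalRealSubfield L)) L (IsCMField.complexConj L) 3).Adelic) * k) : ℝ) ^ z.re := by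
  -- (0) place data independent of `k`, `X`, `b`: curvatures `c_w = (w δ)² > 0`, coordinate forms `ℓ_w`, the affine-uniform constants of ★ (a1ᵘ)
  set c : InfinitePlace L → ℝ := fun w => (w δ) ^ 2 with hc_def
  have hcpos : ∀ w, 0 < c w := fun w => K2E1HeightBigCellLineFormulaU2.sq_apply_pos_of_ne_zero L hδ w
  set ℓ : InfinitePlace L → (mixedSpace ↥(maximalRealSubfield L) →L[ℝ] ℝ) := fun w =>
    (ContinuousLinearMap.proj (R := ℝ) (φ := fun _ : {v : InfinitePlace ↥(maximalRealSubfield L) // v.IsReal} => ℝ) ⟨w.comap (algebraMap ↥(maximalRealSubfield L) L), K2E1HeightBigCellLineFormulaU2.isReal_comap_maximalRealSubfield L w⟩).comp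
      (ContinuousLinearMap.fst ℝ ({v : InfinitePlace ↥(maximalRealSubfield L) // v.IsReal} → ℝ) ({v : InfinitePlace ↥(maximalRealSubfield L) // v.IsComplex} → ℂ)) with hℓ_def
  have hℓ : ∀ w, ‖ℓ w‖ ≤ 1 := fun w => norm_proj_comp_fst_le_one ↥(maximalRealSubfield L) _
  choose C hC0 hC using fun w : InfinitePlace L => fun j : ℕ => exists_norm_iteratedDeriv_affine_le_uniform (hcpos w) z j
  set Cmax : ℝ := ∑ w : InfinitePlace L, ∑ j ∈ Finset.range (m + 1), C w j with hCmax_def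
  have hCmax0 : 0 ≤ Cmax := Finset.sum_nonneg fun w _ => Finset.sum_nonneg fun j _ => hC0 w j
  have hCle : ∀ w, ∀ j ≤ m, C w j ≤ Cmax := by
    intro w j hj
    calc C w j ≤ ∑ j ∈ Finset.range (m + 1), C w j :=
          Finset.single_le_sum (f := fun j => C w j) (fun i _ => hC0 w i) (Finset.mem_range.2 (Nat.lt_succ_of_le hj))
      _ ≤ Cmax := Finset.single_le_sum (f := fun w => ∑ j ∈ Finset.range (m + 1), C w j) (fun w _ => Finset.sum_nonneg fun j _ => hC0 w j) (Finset.mem_univ w)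
  refine ⟨‖φ₀‖ * (2 ^ m * Cmax) ^ (Finset.univ : Finset (InfinitePlace L)).card, by positivity, fun k hk X b => ?_⟩
  -- (1) the shift `X` enters only through `A_w = (1 + ½‖X_w‖²)² ≥ 1`
  set A : InfinitePlace L → ℝ := fun w => (1 + ‖X.1 w‖ ^ 2 / 2) ^ 2 with hA_def
  have hA1 : ∀ w, 1 ≤ A w := fun w => one_le_sq_one_add_half_norm_sq L X w
  have hA0 : ∀ w, 0 < A w := fun w => zero_lt_one.trans_le (hA1 w)
  set Fw : InfinitePlace L → ℝ → ℂ := fun w u => ((((A w + c w * u ^ 2 : ℝ)) : ℂ) ^ (-z)) with hFw_def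
  have hF : ∀ w, ContDiff ℝ (m : ℕ∞) (Fw w) := fun w => contDiff_affinePow (hA0 w) (hcpos w).le z
  set g : InfinitePlace L → mixedSpace ↥(maximalRealSubfield L) → ℂ := fun w => Fw w ∘ ℓ w with hg_def
  have hg : ∀ w ∈ (Finset.univ : Finset (InfinitePlace L)), ContDiff ℝ (m : ℕ∞) (g w) := fun w _ => (hF w).comp (ℓ w).contDiff
  set e : InfinitePlace L → mixedSpace ↥(maximalRealSubfield L) → ℝ := fun w s => (A w + c w * (ℓ w s) ^ 2) ^ (-z.re) with he_def
  have he : ∀ w ∈ (Finset.univ : Finset (InfinitePlace L)), ∀ s, 0 ≤ e w s := fun w _ s => Real.rpow_nonneg (affine_pos (hA0 w) (hcpos w).le _).le _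
  have hb : ∀ w ∈ (Finset.univ : Finset (InfinitePlace L)), ∀ j ≤ m, ∀ s, ‖iteratedFDeriv ℝ j (g w) s‖ ≤ Cmax * e w s := by
    intro w _ j hj s
    have hjm : (j : WithTop ℕ∞) ≤ (m : ℕ∞) := by exact_mod_cast hj
    calc ‖iteratedFDeriv ℝ j (g w) s‖ ≤ ‖iteratedDeriv j (Fw w) (ℓ w s)‖ := norm_iteratedFDeriv_comp_form_le (hF w) (ℓ w) (hℓ w) s hjm
      _ ≤ C w j * (A w + c w * (ℓ w s) ^ 2) ^ (-z.re) := hC w j (A w) (hA1 w) (c w) (hcpos w) le_rfl (ℓ w s)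
      _ ≤ Cmax * e w s := mul_le_mul_of_nonneg_right (hCle w j hj) (he w (Finset.mem_univ w) s)
  -- (2) the tensor Leibniz rule with the `X`-independent constant `(2ᵐ C_max)^{#places}`
  obtain ⟨hprod, hbound⟩ := norm_iteratedFDeriv_finset_prod_le_explicit (Finset.univ : Finset (InfinitePlace L)) hg (le_refl _) hCmax0 he hb
  -- (3) the finite factor and the closed form (§2)
  have hhf0 : 0 < ((∏ᶠ v : HeightOneSpectrum (𝓞 L), max 1 (max ‖X.2 v‖₊ ‖(heisZ (c := IsCMField.complexConj L) X ((traceZeroLine ↥(maximalRealSubfield L) L (IsCMField.complexConj L) hcδ hδ ((0, b) : AdeleRing (𝓞 ↥(maximalRealSubfield L)) ↥(maximalRealSubfield L)) : traceZeroAdele ↥(maximalRealSubfield L) L (IsCMField.complexConj L)) : AdeleRing (𝓞 L) L)).2 v‖₊) : ℝ≥0) : ℝ) := zero_lt_one.trans_le (one_le_coe_finprod_heisZ_line_cm_three L hcδ hδ X b)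
  have hfun : ((fun a : InfiniteAdeleRing ↥(maximalRealSubfield L) => flatSectionU (fun _ : (quasiSplit (↥(maximalRealSubfield L)) L (IsCMField.complexConj L) 3).Adelic => φ₀) z (((quasiSplit (↥(maximalRealSubfield L)) L (IsCMField.complexConj L) 3).toAdelic (weylLongU ((IsCMField.complexConj L : L ≃ₐ[↥(maximalRealSubfield L)] L) : L →+* L) (rfl : ((StdForm.antidiagonal 3).over L) = ((StdForm.antidiagonal 3).over L)))) * ((heisChart hc (X, traceZeroLine ↥(maximalRealSubfield L) L (IsCMField.complexConj L) hcδ hδ ((a, b) : AdeleRing (𝓞 ↥(maximalRealSubfield L)) ↥(maximalRealSubfield L))) : ↥(adelicUnipotent ↥(maximalRealSubfield L) L (IsCMField.complexConj L) 3)) : (quasiSplit (↥(maximalRealSubfield L)) L (IsCMField.complexConj L) 3).Adelic) * k)) ∘ (InfiniteAdeleRing.ringEquiv_mixedSpace ↥(maximalRealSubfield L)).symm) = (φ₀ * (((((∏ᶠ v : HeightOneSpectrum (𝓞 L), max 1 (max ‖X.2 v‖₊ ‖(heisZ (c := IsCMField.complexConj L) X ((traceZeroLine ↥(maximalRealSubfield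 L) L (IsCMField.complexConj L) hcδ hδ ((0, b) : AdeleRing (𝓞 ↥(maximalRealSubfield L)) ↥(maximalRealSubfield L)) : traceZeroAdele ↥(maximalRealSubfield L) L (IsCMField.complexConj L)) : AdeleRing (𝓞 L) L)).2 v‖₊) : ℝ≥0) : ℝ))⁻¹ : ℝ) : ℂ) ^ z) • fun s => ∏ w, g w s := by
    funext s
    rw [flatSectionU_const_heisChart_line_apply_cm_three L hc hcδ hδ z φ₀ hk X b s, Pi.smul_apply, smul_eq_mul, mul_assoc]
    rfl
  have hcd : ContDiff ℝ m ((φ₀ * (((((∏ᶠ v : HeightOneSpectrum (𝓞 L), max 1 (max ‖X.2 v‖₊ ‖(heisZ (c := IsCMField.complexConj L) X ((traceZeroLine ↥(maximalRealSubfield L) L (IsCMField.complexConj L) hcδ hδ ((0, b) : AdeleRing (𝓞 ↥(maximalRealSubfield L)) ↥(maximalRealSubfield L)) : traceZeroAdele ↥(maximalRealSubfield L) L (IsCMField.complexConj L)) : AdeleRing (𝓞 L) L)).2 v‖₊) : ℝ≥0) : ℝ))⁻¹ : ℝ) : ℂ) ^ z) • fun s => ∏ w, g w s) := hprod.const_smul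 (φ₀ * (((((∏ᶠ v : HeightOneSpectrum (𝓞 L), max 1 (max ‖X.2 v‖₊ ‖(heisZ (c := IsCMField.complexConj L) X ((traceZeroLine ↥(maximalRealSubfield L) L (IsCMField.complexConj L) hcδ hδ ((0, b) : AdeleRing (𝓞 ↥(maximalRealSubfield L)) ↥(maximalRealSubfield L)) : traceZeroAdele ↥(maximalRealSubfield L) L (IsCMField.complexConj L)) : AdeleRing (𝓞 L) L)).2 v‖₊) : ℝ≥0) : ℝ))⁻¹ : ℝ) : ℂ) ^ z)
  refine ⟨by rw [hfun]; exact hcd, fun j hj s => ?_⟩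
  rw [hfun, iteratedFDeriv_const_smul_apply ((hprod.of_le (by exact_mod_cast hj)).contDiffAt), _root_.norm_smul]
  -- (4) `‖φ₀‖·h_f^{−Re z}·(2ᵐC_max)^# · ∏_w (A_w + c_w s_w²)^{−Re z} = C_φ · H^{Re z}`
  have hA : ‖(φ₀ * (((((∏ᶠ v : HeightOneSpectrum (𝓞 L), max 1 (max ‖X.2 v‖₊ ‖(heisZ (c := IsCMField.complexConj L) X ((traceZeroLine ↥(maximalRealSubfield L) L (IsCMField.complexConj L) hcδ hδ ((0, b) : AdeleRing (𝓞 ↥(maximalRealSubfield L)) ↥(maximalRealSubfield L)) : traceZeroAdele ↥(maximalRealSubfield L) L (IsCMField.complexConj L)) : AdeleRing (𝓞 L) L)).2 v‖₊) : ℝ≥0) : ℝ))⁻¹ : ℝ) : ℂ) ^ z)‖ = ‖φ₀‖ * ‖(((((∏ᶠ v : HeightOneSpectrum (𝓞 L), max 1 (max ‖X.2 v‖₊ ‖(heisZ (c := IsCMField.complexConj L) X ((traceZeroLine ↥(maximalRealSubfield L) L (IsCMField.complexConj L) hcδ hδ ((0, b) : AdeleRing (𝓞 ↥(maximalRealSubfield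 L)) ↥(maximalRealSubfield L)) : traceZeroAdele ↥(maximalRealSubfield L) L (IsCMField.complexConj L)) : AdeleRing (𝓞 L) L)).2 v‖₊) : ℝ≥0) : ℝ))⁻¹ : ℝ) : ℂ) ^ z‖ := norm_mul _ _
  have hH : ‖(((((∏ᶠ v : HeightOneSpectrum (𝓞 L), max 1 (max ‖X.2 v‖₊ ‖(heisZ (c := IsCMField.complexConj L) X ((traceZeroLine ↥(maximalRealSubfield L) L (IsCMField.complexConj L) hcδ hδ ((0, b) : AdeleRing (𝓞 ↥(maximalRealSubfield L)) ↥(maximalRealSubfield L)) : traceZeroAdele ↥(maximalRealSubfield L) L (IsCMField.complexConj L)) : AdeleRing (𝓞 L) L)).2 v‖₊) : ℝ≥0) : ℝ))⁻¹ : ℝ) : ℂ) ^ z‖ * ∏ w, e w s = (borelHeight (((quasiSplit (↥(maximalRealSubfield L)) L (IsCMField.complexConj L) 3).toAdelic (weylLongU ((IsCMField.complexConj L : L ≃ₐ[↥(maximalRealSubfield L)] L) : L →+* L) (rfl : ((StdForm.antidiagonal 3).over L) = ((StdForm.antidiagonal 3).over L)))) * ((heisChart hc (X, traceZeroLine ↥(maximalRealSubfield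 L) L (IsCMField.complexConj L) hcδ hδ ((((InfiniteAdeleRing.ringEquiv_mixedSpace ↥(maximalRealSubfield L)).symm s), b) : AdeleRing (𝓞 ↥(maximalRealSubfield L)) ↥(maximalRealSubfield L))) : ↥(adelicUnipotent ↥(maximalRealSubfield L) L (IsCMField.complexConj L) 3)) : (quasiSplit (↥(maximalRealSubfield L)) L (IsCMField.complexConj L) 3).Adelic) * k) : ℝ) ^ z.re := by
    rw [coe_borelHeight_weylLongU_heisChart_line_mul_eq_cm_three L hc hcδ hδ hk X b s,
      ← norm_ofReal_inv_cpow_mul_prod_rpow_neg Finset.univ (fun w _ => (affine_pos (hA0 w) (hcpos w).le _).le) hhf0 z]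
    rfl
  calc ‖(φ₀ * (((((∏ᶠ v : HeightOneSpectrum (𝓞 L), max 1 (max ‖X.2 v‖₊ ‖(heisZ (c := IsCMField.complexConj L) X ((traceZeroLine ↥(maximalRealSubfield L) L (IsCMField.complexConj L) hcδ hδ ((0, b) : AdeleRing (𝓞 ↥(maximalRealSubfield L)) ↥(maximalRealSubfield L)) : traceZeroAdele ↥(maximalRealSubfield L) L (IsCMField.complexConj L)) : AdeleRing (𝓞 L) L)).2 v‖₊) : ℝ≥0) : ℝ))⁻¹ : ℝ) : ℂ) ^ z)‖ * ‖iteratedFDeriv ℝ j (fun s => ∏ w, g w s) s‖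
        ≤ ‖(φ₀ * (((((∏ᶠ v : HeightOneSpectrum (𝓞 L), max 1 (max ‖X.2 v‖₊ ‖(heisZ (c := IsCMField.complexConj L) X ((traceZeroLine ↥(maximalRealSubfield L) L (IsCMField.complexConj L) hcδ hδ ((0, b) : AdeleRing (𝓞 ↥(maximalRealSubfield L)) ↥(maximalRealSubfield L)) : traceZeroAdele ↥(maximalRealSubfield L) L (IsCMField.complexConj L)) : AdeleRing (𝓞 L) L)).2 v‖₊) : ℝ≥0) : ℝ))⁻¹ : ℝ) : ℂ) ^ z)‖ * ((2 ^ m * Cmax) ^ (Finset.univ : Finset (InfinitePlace L)).card * ∏ w, e w s) := mul_le_mul_of_nonneg_left (hbound j hj s) (norm_nonneg _)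
    _ = ‖φ₀‖ * (2 ^ m * Cmax) ^ (Finset.univ : Finset (InfinitePlace L)).card * (‖(((((∏ᶠ v : HeightOneSpectrum (𝓞 L), max 1 (max ‖X.2 v‖₊ ‖(heisZ (c := IsCMField.complexConj L) X ((traceZeroLine ↥(maximalRealSubfield L) L (IsCMField.complexConj L) hcδ hδ ((0, b) : AdeleRing (𝓞 ↥(maximalRealSubfield L)) ↥(maximalRealSubfield L)) : traceZeroAdele ↥(maximalRealSubfield L) L (IsCMField.complexConj L)) : AdeleRing (𝓞 L) L)).2 v‖₊) : ℝ≥0) : ℝ))⁻¹ : ℝ) : ℂ) ^ z‖ * ∏ w, e w s) := by rw [hA]; ring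
    _ = _ := by rw [hH]

end ArchSmooth

/-! ## §4 The consumer, spherical case: the centre-layer triple of ★ p857895 with `hφarch`, `h𝓔U` discharged -/

section Plug

open MeasureTheory
open Summit.HodgeConjecture.HodgeConjecture.Cruxes.H413.K2E1FlatSectionLineRestrictionArchU3

variable (L : Type) [Field L] [NumberField L] [IsCMField L]
  [MeasurableSpace (AdeleRing (𝓞 ↥(maximalRealSubfield L)) ↥(maximalRealSubfield L))] [BorelSpace (AdeleRing (𝓞 ↥(maximalRealSubfield L)) ↥(maximalRealSubfield L))]
  [MeasurableSpace (InfiniteAdeleRing ↥(maximalRealSubfield L))] [BorelSpace (InfiniteAdeleRing ↥(maximalRealSubfield L))]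
  [MeasurableSpace (FiniteAdeleRing (𝓞 ↥(maximalRealSubfield L)) ↥(maximalRealSubfield L))] [BorelSpace (FiniteAdeleRing (𝓞 ↥(maximalRealSubfield L)) ↥(maximalRealSubfield L))]

/-- **THE CENTRE-LAYER (F) FIBREWISE TRIPLE FOR THE SPHERICAL FLAT SECTION OF `U(2,1)` OVER A CM FIELD** — ★ p857895 `exists_fibre_majorant_centre_of_archSmooth_three` at
`f := flatSectionU (fun _ => φ₀) z`, `K := K_U`, `𝓔 := C_φ·H^{Re z}` with `hφarch` (§3) and `h𝓔U` (level letter `U₀ ≤ GL₃(𝒪̂_L)`, ★ `borelHeight_mul_of_mem_comap_standardMaximalCompactGL`)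
DISCHARGED: given the integrability of `t ↦ H(ι(w₀)·u(X, θ t)·k)^{Re z}` along every centre line with `∫ ≤ N(X)`, there are `C'' ≥ 0` and majorants `A k X` with `∫ A k X dμ₂ ≤ C''·N(X)` and
`‖∫ f_z(ι(w₀)·u(X, θ(a, b))·k)·ψ(y a) dμ₁(a)‖ ≤ A k X b·(1 + ‖ι y‖)^{−m}`. [cite: MoeglinWaldspurger1995, I.2.10–I.2.12, II.1.7] [cite: Garrett2018, §2.9, §12.2] -/
theorem exists_fibre_majorant_centre_const_cm_three (hc : IsCMField.complexConj L * IsCMField.complexConj L = 1) {δ : L} (hcδ : IsCMField.complexConj L δ = -δ) (hδ : δ ≠ 0)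
    (μ : Measure (AdeleRing (𝓞 ↥(maximalRealSubfield L)) ↥(maximalRealSubfield L))) [μ.IsAddHaarMeasure]
    (μ₁ : Measure (InfiniteAdeleRing ↥(maximalRealSubfield L))) [μ₁.IsAddHaarMeasure] (μ₂ : Measure (FiniteAdeleRing (𝓞 ↥(maximalRealSubfield L)) ↥(maximalRealSubfield L))) [μ₂.IsAddHaarMeasure]
    {U₀ : Subgroup (GL (Fin 3) (FiniteAdeleRing (𝓞 L) L))} (hU₀o : IsOpen (U₀ : Set (GL (Fin 3) (FiniteAdeleRing (𝓞 L) L)))) (hU₀K : U₀ ≤ glFiniteIntegralLevel 3 L)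
    (z φ₀ : ℂ) (m : ℕ) {N : AdeleRing (𝓞 L) L → ℝ}
    (hHi : ∀ k ∈ (((standardMaximalCompactGL 3 L).comap (adelicVal ↥(maximalRealSubfield L) L (IsCMField.complexConj L) 3 ((StdForm.antidiagonal 3).over L)) : Subgroup (quasiSplit (↥(maximalRealSubfield L)) L (IsCMField.complexConj L) 3).Adelic) : Set (quasiSplit (↥(maximalRealSubfield L)) L (IsCMField.complexConj L) 3).Adelic), ∀ X : AdeleRing (𝓞 L) L,
      Integrable (fun t : AdeleRing (𝓞 ↥(maximalRealSubfield L)) ↥(maximalRealSubfield L) => (borelHeight (((quasiSplit (↥(maximalRealSubfield L)) L (IsCMField.complexConj L) 3).toAdelic (weylLongU ((IsCMField.complexConj L : L ≃ₐ[↥(maximalRealSubfield L)] L) : L →+* L) (rfl : ((StdForm.antidiagonal 3).over L) = ((StdForm.antidiagonal 3).over L)))) * ((heisChart hc (X, traceZeroLine ↥(maximalRealSubfield L) L (IsCMField.complexConj L) hcδ hδ t) : ↥(adelicUnipotent ↥(maximalRealSubfield L) L (IsCMField.complexConj L) 3)) : (quasiSplit (↥(maximalRealSubfield L)) L (IsCMField.complexConj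 L) 3).Adelic) * k) : ℝ) ^ z.re) μ)
    (hHN : ∀ k ∈ (((standardMaximalCompactGL 3 L).comap (adelicVal ↥(maximalRealSubfield L) L (IsCMField.complexConj L) 3 ((StdForm.antidiagonal 3).over L)) : Subgroup (quasiSplit (↥(maximalRealSubfield L)) L (IsCMField.complexConj L) 3).Adelic) : Set (quasiSplit (↥(maximalRealSubfield L)) L (IsCMField.complexConj L) 3).Adelic), ∀ X : AdeleRing (𝓞 L) L,
      ∫ t : AdeleRing (𝓞 ↥(maximalRealSubfield L)) ↥(maximalRealSubfield L), (borelHeight (((quasiSplit (↥(maximalRealSubfield L)) L (IsCMField.complexConj L) 3).toAdelic (weylLongU ((IsCMField.complexConj L : L ≃ₐ[↥(maximalRealSubfield L)] L) : L →+* L) (rfl : ((StdForm.antidiagonal 3).over L) = ((StdForm.antidiagonal 3).over L)))) * ((heisChart hc (X, traceZeroLine ↥(maximalRealSubfield L) L (IsCMField.complexConj L) hcδ hδ t) : ↥(adelicUnipotent ↥(maximalRealSubfield L) L (IsCMField.complexConj L) 3)) : (quasiSplit (↥(maximalRealSubfield L)) L (IsCMField.complexConj L) 3).Adelic) * k) :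 ℝ) ^ z.re ∂μ ≤ N X) :
    ∃ C'' : ℝ, 0 ≤ C'' ∧ ∃ A : (quasiSplit (↥(maximalRealSubfield L)) L (IsCMField.complexConj L) 3).Adelic → AdeleRing (𝓞 L) L → FiniteAdeleRing (𝓞 ↥(maximalRealSubfield L)) ↥(maximalRealSubfield L) → ℝ,
      (∀ k ∈ (((standardMaximalCompactGL 3 L).comap (adelicVal ↥(maximalRealSubfield L) L (IsCMField.complexConj L) 3 ((StdForm.antidiagonal 3).over L)) : Subgroup (quasiSplit (↥(maximalRealSubfield L)) L (IsCMField.complexConj L) 3).Adelic) : Set (quasiSplit (↥(maximalRealSubfield L)) L (IsCMField.complexConj L) 3).Adelic), ∀ X : AdeleRing (𝓞 L) L, Integrable (A k X) μ₂ ∧ ∫ b, A k X b ∂μ₂ ≤ C'' * N X) ∧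
      ∀ k ∈ (((standardMaximalCompactGL 3 L).comap (adelicVal ↥(maximalRealSubfield L) L (IsCMField.complexConj L) 3 ((StdForm.antidiagonal 3).over L)) : Subgroup (quasiSplit (↥(maximalRealSubfield L)) L (IsCMField.complexConj L) 3).Adelic) : Set (quasiSplit (↥(maximalRealSubfield L)) L (IsCMField.complexConj L) 3).Adelic), ∀ (X : AdeleRing (𝓞 L) L) (b : FiniteAdeleRing (𝓞 ↥(maximalRealSubfield L)) ↥(maximalRealSubfield L)) (y : InfiniteAdeleRing ↥(maximalRealSubfield L)),
        ‖∫ a, flatSectionU (fun _ : (quasiSplit (↥(maximalRealSubfield L)) L (IsCMField.complexConj L) 3).Adelic => φ₀) z (((quasiSplit (↥(maximalRealSubfield L)) L (IsCMField.complexConj L) 3).toAdelic (weylLongU ((IsCMField.complexConj L : L ≃ₐ[↥(maximalRealSubfield L)] L) : L →+* L) (rfl : ((StdForm.antidiagonal 3).over L) = ((StdForm.antidiagonal 3).over L)))) * ((heisChart hc (X, traceZeroLine ↥(maximalRealSubfield L) L (IsCMField.complexConj L) hcδ hδ ((a, b) : AdeleRing (𝓞 ↥(maximalRealSubfield L)) ↥(maximalRealSubfield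 L))) : ↥(adelicUnipotent ↥(maximalRealSubfield L) L (IsCMField.complexConj L) 3)) : (quasiSplit (↥(maximalRealSubfield L)) L (IsCMField.complexConj L) 3).Adelic) * k) * (adeleAddChar ↥(maximalRealSubfield L) (infiniteAdeleInl ↥(maximalRealSubfield L) (y * a)) : ℂ) ∂μ₁‖ ≤
          A k X b * (1 + ‖InfiniteAdeleRing.ringEquiv_mixedSpace ↥(maximalRealSubfield L) y‖) ^ (-(m : ℝ)) := by
  obtain ⟨Cφ, hCφ, hφarch⟩ := exists_archSmooth_flatSectionU_const_cm_three L hc hcδ hδ z φ₀ m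
  have h𝓔U : ∀ u : (quasiSplit (↥(maximalRealSubfield L)) L (IsCMField.complexConj L) 3).Adelic, adelicVal ↥(maximalRealSubfield L) L (IsCMField.complexConj L) 3 ((StdForm.antidiagonal 3).over L) u ∈ U₀.map (GLn.ofFinite 3 L) →
      ∀ y : (quasiSplit (↥(maximalRealSubfield L)) L (IsCMField.complexConj L) 3).Adelic, (fun y : (quasiSplit (↥(maximalRealSubfield L)) L (IsCMField.complexConj L) 3).Adelic => Cφ * (borelHeight y : ℝ) ^ z.re) (y * u) = (fun y : (quasiSplit (↥(maximalRealSubfield L)) L (IsCMField.complexConj L) 3).Adelic => Cφ * (borelHeight y : ℝ) ^ z.re) y := by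
    intro u hu y
    obtain ⟨w, hw, hwu⟩ := Subgroup.mem_map.1 hu
    have hk : u ∈ ((standardMaximalCompactGL 3 L).comap (adelicVal ↥(maximalRealSubfield L) L (IsCMField.complexConj L) 3 ((StdForm.antidiagonal 3).over L)) : Subgroup (quasiSplit (↥(maximalRealSubfield L)) L (IsCMField.complexConj L) 3).Adelic) :=
      Subgroup.mem_comap.2 (by rw [← hwu]; exact glIntegralLevel_le_standardMaximalCompactGL (GLn.ofFinite_mem_glIntegralLevel (hU₀K hw)))
    simp only [borelHeight_mul_of_mem_comap_standardMaximalCompactGL hk y]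
  have h𝓔i : ∀ k ∈ (((standardMaximalCompactGL 3 L).comap (adelicVal ↥(maximalRealSubfield L) L (IsCMField.complexConj L) 3 ((StdForm.antidiagonal 3).over L)) : Subgroup (quasiSplit (↥(maximalRealSubfield L)) L (IsCMField.complexConj L) 3).Adelic) : Set (quasiSplit (↥(maximalRealSubfield L)) L (IsCMField.complexConj L) 3).Adelic), ∀ X : AdeleRing (𝓞 L) L,
      Integrable (fun t : AdeleRing (𝓞 ↥(maximalRealSubfield L)) ↥(maximalRealSubfield L) => (fun y : (quasiSplit (↥(maximalRealSubfield L)) L (IsCMField.complexConj L) 3).Adelic => Cφ * (borelHeight y : ℝ) ^ z.re) (((quasiSplit (↥(maximalRealSubfield L)) L (IsCMField.complexConj L) 3).toAdelic (weylLongU ((IsCMField.complexConj L : L ≃ₐ[↥(maximalRealSubfield L)] L) : L →+* L) (rfl : ((StdForm.antidiagonal 3).over L) = ((StdForm.antidiagonal 3).over L)))) * ((heisChart hc (X, traceZeroLine ↥(maximalRealSubfield L) L (IsCMField.complexConj L) hcδ hδ t) : ↥(adelicUnipotent ↥(maximalRealSubfield L) L (IsCMField.complexConj L) 3)) : (quasiSplit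 (↥(maximalRealSubfield L)) L (IsCMField.complexConj L) 3).Adelic) * k)) μ :=
    fun k hk X => (hHi k hk X).const_mul Cφ
  have h𝓔N : ∀ k ∈ (((standardMaximalCompactGL 3 L).comap (adelicVal ↥(maximalRealSubfield L) L (IsCMField.complexConj L) 3 ((StdForm.antidiagonal 3).over L)) : Subgroup (quasiSplit (↥(maximalRealSubfield L)) L (IsCMField.complexConj L) 3).Adelic) : Set (quasiSplit (↥(maximalRealSubfield L)) L (IsCMField.complexConj L) 3).Adelic), ∀ X : AdeleRing (𝓞 L) L,
      ∫ t : AdeleRing (𝓞 ↥(maximalRealSubfield L)) ↥(maximalRealSubfield L), (fun y : (quasiSplit (↥(maximalRealSubfield L)) L (IsCMField.complexConj L) 3).Adelic => Cφ * (borelHeight y : ℝ) ^ z.re) (((quasiSplit (↥(maximalRealSubfield L)) L (IsCMField.complexConj L) 3).toAdelic (weylLongU ((IsCMField.complexConj L : L ≃ₐ[↥(maximalRealSubfield L)] L) : L →+* L) (rfl : ((StdForm.antidiagonal 3).over L) = ((StdForm.antidiagonal 3).over L)))) * ((heisChart hc (X, traceZeroLine ↥(maximalRealSubfield L) L (IsCMField.complexConj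 L) hcδ hδ t) : ↥(adelicUnipotent ↥(maximalRealSubfield L) L (IsCMField.complexConj L) 3)) : (quasiSplit (↥(maximalRealSubfield L)) L (IsCMField.complexConj L) 3).Adelic) * k) ∂μ ≤ Cφ * N X := by
    intro k hk X
    have h := integral_const_mul Cφ (fun t : AdeleRing (𝓞 ↥(maximalRealSubfield L)) ↥(maximalRealSubfield L) => (borelHeight (((quasiSplit (↥(maximalRealSubfield L)) L (IsCMField.complexConj L) 3).toAdelic (weylLongU ((IsCMField.complexConj L : L ≃ₐ[↥(maximalRealSubfield L)] L) : L →+* L) (rfl : ((StdForm.antidiagonal 3).over L) = ((StdForm.antidiagonal 3).over L)))) * ((heisChart hc (X, traceZeroLine ↥(maximalRealSubfield L) L (IsCMField.complexConj L) hcδ hδ t) : ↥(adelicUnipotent ↥(maximalRealSubfield L) L (IsCMField.complexConj L) 3)) : (quasiSplit (↥(maximalRealSubfield L)) L (IsCMField.complexConj L) 3).Adelic) * k) : ℝ) ^ z.re) (μ := μ)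
    dsimp only at h ⊢
    rw [h]
    exact mul_le_mul_of_nonneg_left (hHN k hk X) hCφ
  obtain ⟨C', hC', A, hA, hdec⟩ := exists_fibre_majorant_centre_of_archSmooth_three (F := ↥(maximalRealSubfield L)) (E := L) (c := IsCMField.complexConj L) hc hcδ hδ μ μ₁ μ₂
    isCompact_comap_adelicVal_standardMaximalCompactGL hU₀o (f := flatSectionU (fun _ : (quasiSplit (↥(maximalRealSubfield L)) L (IsCMField.complexConj L) 3).Adelic => φ₀) z)
    (𝓔 := fun y : (quasiSplit (↥(maximalRealSubfield L)) L (IsCMField.complexConj L) 3).Adelic => Cφ * (borelHeight y : ℝ) ^ z.re) h𝓔U (N := fun X => Cφ * N X) h𝓔i h𝓔N (m := m) hφarch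
  refine ⟨C' * Cφ, mul_nonneg hC' hCφ, A, fun k hk X => ⟨(hA k hk X).1, ?_⟩, hdec⟩
  have h := (hA k hk X).2
  rw [mul_assoc]
  exact h

end Plug

end Summit.HodgeConjecture.HodgeConjecture.Cruxes.H413.K2E1HeightLineArchSmoothU3

end
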